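import Literature.Barriers.QuantumFields.FiniteTemperatureOneLayer
import Literature.Probability.LatticeModels.NVectorInfraredBoundProofs
import HarnessLib

/-!
# The one-layer model: reflections of the torus through bond-bisecting hyperplanes

Companion to `Literature.Barriers.QuantumFields.FiniteTemperatureOneLayer` (Borgs–Seiler's
one-layer model on `(ℤ/L)^d`, configurations `OneLayer.Config d L G = TorusSite d L × Dir d → G`).
For a spatial direction `j` and `k ∈ ℤ/L` let `r = Torus.reflectBetweenSites j k : x_j ↦ 2k+1-x_j`
be the reflection of the torus through the hyperplanes bisecting the bonds `{k, k+1}` and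
`{k + L/2, k + L/2 + 1}` in direction `j` (the tree's `ReflectionPositivity.lean` /
`GaussianDominationProofs.lean`). This file proves the bookkeeping of the induced reflection of
the one-layer lattice gauge theory:

* `OneLayer.reflect j k` — the reflection `Θ` on configurations: `u_x ↦ u_{rx}`,
  `v_{x,i} ↦ v_{rx,i}` (`i ≠ j`), and `v_{x,j} ↦ v_{r(x+e_j), j}⁻¹ = v_{rx - e_j, j}⁻¹` (the
  reflected `j`-link, traversed backwards); an involution preserving the product Haar measure
  (`reflect_reflect`, `measurePreserving_reflect`).
* Plaquettes and Polyakov loops under `Θ`: electric and magnetic plaquettes go to (conjugates of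
  inverses of) the plaquettes at the mirror base point, so `Re tr ρ` is carried along
  (`trace_re_eplaq_reflect`, `trace_re_mplaq_reflect`), and `χ(u_x) ∘ Θ = χ(u_{rx})`
  (`polyakov_reflect`).
* The coordinate `n(x) = (x_j - k).val ∈ {0,…,L-1}` across the mirror (`jv`) and its arithmetic
  (`jv_add_single_self`, `jv_sub_single_self`, `jv_mirror`, …): the positive half is
  `1 ≤ n ≤ L/2`, the crossing `j`-bonds sit at `n ∈ {0, L/2}`.
* The blocks of links: `posLinks` (links with both endpoints in the positive half), and the facts
  that `Θ` carries them into the complement and that a function of the positive links composed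
  with `Θ` depends only on the other links (`reflect_apply_dependsOn`) — the hypotheses of the
  abstract reflection-positivity lemmas of `LatticeRPMechanism`.
* **Gauge fixing of the crossing links** (`integral_eq_integral_splice_crossLinks_one`): for
  every bounded measurable GAUGE-INVARIANT `f`, `∫ f dμ = ∫ f(U with the crossing j-links set to 1) dμ(U)`
  (axial gauge on the matching formed by the crossing links: the gauge transformation
  `g(x + e_j) = U(x, j)` at the heads of the crossing links, `g = 1` elsewhere, kills them, and is a
  measure-preserving change of the remaining variables for fixed crossing values).
* **The Cauchy–Schwarz inequality of reflection positivity with two different crossing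
  couplings** (`integral_mul_comp_mul_exp_sq_le`): for `Θ` measure preserving with the positive
  coordinates of `Θ U` depending only on `U` off `P`, bounded measurable `Φ, Ψ, p_c, q_c` depending
  only on the `P`-coordinates and `β ≥ 0`,
  `(∫ Φ(U) Ψ(ΘU) e^{β ∑_c p_c(U) q_c(ΘU)})² ≤ (∫ Φ Φ∘Θ e^{β∑ p p∘Θ}) (∫ Ψ Ψ∘Θ e^{β∑ q q∘Θ})`
  — Friedli–Velenik's Lemma 10.28 / Fröhlich–Israel–Lieb–Simon's `e^{A + ΘB + ∑ C_i ΘD_i}`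
  estimate, proved as in the tree's `NVector.kerInt_sq_le` (expand the exponential, factorise each
  word by independence of the two half-spaces and `Θ`-invariance, Cauchy–Schwarz termwise, resum).

Everything here is proved; no facts. It serves the Gaussian-domination proof of Borgs–Seiler's
one-layer infrared bound (Thm III.4) in `FiniteTemperatureOneLayerGD` /
`FiniteTemperatureOneLayerInfrared`.

References: C. Borgs, E. Seiler, Commun. Math. Phys. 91 (1983) 329–380, §II.2 (reflection
positivity "in planes lying half-way between lattice planes", pp. 331–332), §III.1 (pp. 344–346);
S. Friedli, Y. Velenik, *Statistical Mechanics of Lattice Systems* (CUP 2017), §10.3 and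
Lemma 10.28; K. Osterwalder, E. Seiler, Ann. Phys. 110 (1978) 440, §2. [BorgsSeiler1983]
[FriedliVelenik2017]
-/

noncomputable section

open MeasureTheory Filter Topology
open scoped ComplexConjugate

namespace Literature.Barriers.QuantumFields

namespace OneLayer

open Literature.Probability.LatticeModels (TorusSite Torus.reflectBetweenSites)
open Literature.MathematicalPhysics.QuantumFieldTheory (haarProbability)
open Literature.MathematicalPhysics.QuantumFieldTheory.LatticeRP (piMeasure splice splice_apply)
open FiniteTemperature (Dir)

variable {d L : ℕ} {G : Type*} [Group G] {N : ℕ}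

/-! ### The mirror `r : x_j ↦ 2k + 1 - x_j` -/

section Mirror

variable (j : Fin d) (k : ZMod L)

/-- The mirror map of the torus through the bond-bisecting hyperplanes in direction `j`
(the tree's `Torus.reflectBetweenSites j k`, `x_j ↦ 2k + 1 - x_j`). [cite: FriedliVelenik2017, §10.3, eq. (10.1)] -/
abbrev mirror : TorusSite d L ≃ TorusSite d L := Torus.reflectBetweenSites j k

/-- The mirror is an involution. [folklore] -/
theorem mirror_mirror (x : TorusSite d L) : mirror j k (mirror j k x) = x :=
  Literature.Probability.LatticeModels.Torus.reflectBetweenSites_involutive j k x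

/-- The mirror commutes with translations parallel to it. [folklore] -/
theorem mirror_add_single_of_ne {i : Fin d} (hi : i ≠ j) (x : TorusSite d L) :
    mirror j k (x + Pi.single i 1) = mirror j k x + Pi.single i 1 :=
  Literature.Probability.LatticeModels.Torus.reflectBetweenSites_add_single_of_ne j k x hi

/-- The mirror reverses the translation across it: `r(x + e_j) = r x - e_j`. [folklore] -/
theorem mirror_add_single_self (x : TorusSite d L) :
    mirror j k (x + Pi.single j 1) = mirror j k x - Pi.single j 1 :=
  eq_sub_of_add_eq
    (Literature.Probability.LatticeModels.Torus.reflectBetweenSites_eq_add_single j k x).symm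

/-- `r(x - e_j) = r x + e_j`. [folklore] -/
theorem mirror_sub_single_self (x : TorusSite d L) :
    mirror j k (x - Pi.single j 1) = mirror j k x + Pi.single j 1 := by
  have h := mirror_add_single_self j k (x - Pi.single j 1)
  rw [sub_add_cancel] at h
  rw [h, sub_add_cancel]

/-- The mirror fixes the coordinates other than `j`. [folklore] -/
theorem mirror_apply_of_ne {i : Fin d} (hi : i ≠ j) (x : TorusSite d L) : mirror j k x i = x i :=
  Literature.Probability.LatticeModels.Torus.reflectBetweenSites_apply_of_ne j k x hi

/-- The `j`-th coordinate of the mirror image. [folklore] -/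
theorem mirror_apply_self (x : TorusSite d L) : mirror j k x j = 2 * k + 1 - x j :=
  Literature.Probability.LatticeModels.Torus.reflectBetweenSites_apply_self j k x

end Mirror

/-! ### The coordinate across the mirror, `n(x) = (x_j - k).val` -/

section JV

variable (j : Fin d) (k : ZMod L)

/-- The representative `n(x) ∈ {0, …, L-1}` of `x_j - k`: the positive half is `1 ≤ n ≤ L/2`,
the crossing `j`-bonds start at `n ∈ {0, L/2}`. [cite: FriedliVelenik2017, §10.3, eq. (10.2)] -/
def jv (x : TorusSite d L) : ℕ := (x j - k).val

/-- Translations parallel to the mirror do not change `n`. [folklore] -/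
theorem jv_add_single_of_ne {i : Fin d} (hi : i ≠ j) (x : TorusSite d L) :
    jv j k (x + Pi.single i 1) = jv j k x := by
  simp [jv, Pi.add_apply, hi.symm]

/-- `n(x - e_i) = n(x)` for `i ≠ j`. [folklore] -/
theorem jv_sub_single_of_ne {i : Fin d} (hi : i ≠ j) (x : TorusSite d L) :
    jv j k (x - Pi.single i 1) = jv j k x := by
  simp [jv, Pi.sub_apply, hi.symm]

variable [NeZero L]

/-- `n(x) < L`. [folklore] -/
theorem jv_lt (x : TorusSite d L) : jv j k x < L := ZMod.val_lt _

/-- `n(x + e_j) = n(x) + 1 (mod L)`. [folklore] -/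
theorem jv_add_single_self (x : TorusSite d L) :
    jv j k (x + Pi.single j 1) = if jv j k x + 1 = L then 0 else jv j k x + 1 := by
  unfold jv
  have hx : (x + Pi.single j 1 : TorusSite d L) j - k = (x j - k) + 1 := by
    rw [Pi.add_apply, Pi.single_eq_same]; ring
  rw [hx]
  set t : ZMod L := x j - k
  have hv := Literature.Probability.LatticeModels.ZMod.val_add_one_eq (L := L) t
  have hlt : t.val < L := ZMod.val_lt t
  have hlt' : (t + 1).val < L := ZMod.val_lt _
  split_ifs with h
  · have : (((t + 1).val : ℕ) : ℤ) = 0 := by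
      rw [hv]
      have : ((t.val : ℤ) + 1) = (L : ℤ) := by exact_mod_cast h
      rw [this, Int.emod_self]
    exact_mod_cast this
  · have : (((t + 1).val : ℕ) : ℤ) = (t.val : ℤ) + 1 := by
      rw [hv]; exact Int.emod_eq_of_lt (by omega) (by omega)
    exact_mod_cast this

/-- `n(x - e_j) = n(x) - 1 (mod L)`. [folklore] -/
theorem jv_sub_single_self (x : TorusSite d L) :
    jv j k (x - Pi.single j 1) = if jv j k x = 0 then L - 1 else jv j k x - 1 := by
  unfold jv
  have hx : (x - Pi.single j 1 : TorusSite d L) j - k = (x j - k) - 1 := by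
    rw [Pi.sub_apply, Pi.single_eq_same]; ring
  rw [hx]
  set t : ZMod L := x j - k
  have hv := Literature.Probability.LatticeModels.ZMod.val_sub_one_eq (L := L) t
  have hlt : t.val < L := ZMod.val_lt t
  have hlt' : (t - 1).val < L := ZMod.val_lt _
  have hL : 0 < L := Nat.pos_of_ne_zero (NeZero.ne L)
  split_ifs with h
  · have : (((t - 1).val : ℕ) : ℤ) = (L : ℤ) - 1 := by
      rw [hv, h]
      have h1 : ((0 : ℕ) : ℤ) - 1 = ((L : ℤ) - 1) + (L : ℤ) * (-1) := by push_cast; ring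
      rw [h1, Int.add_mul_emod_self_left]
      exact Int.emod_eq_of_lt (by omega) (by omega)
    omega
  · have : (((t - 1).val : ℕ) : ℤ) = (t.val : ℤ) - 1 := by
      rw [hv]; exact Int.emod_eq_of_lt (by omega) (by omega)
    omega

/-- `n(r x) = 1 - n(x) (mod L)` (for `L ≥ 2`). [folklore] -/
theorem jv_mirror (hL1 : 1 < L) (x : TorusSite d L) :
    jv j k (mirror j k x) = if jv j k x = 0 then 1 else if jv j k x = 1 then 0 else
      L + 1 - jv j k x := by
  unfold jv
  rw [Literature.Probability.LatticeModels.Torus.reflectBetweenSites_apply_self_sub]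
  set t : ZMod L := x j - k
  have hv := Literature.Probability.LatticeModels.ZMod.val_one_sub_eq (L := L) t
  have hlt : t.val < L := ZMod.val_lt t
  have hlt' : (1 - t).val < L := ZMod.val_lt _
  split_ifs with h0 h1
  · have : (((1 - t).val : ℕ) : ℤ) = 1 := by
      rw [hv, h0]; exact Int.emod_eq_of_lt (by omega) (by omega)
    omega
  · have : (((1 - t).val : ℕ) : ℤ) = 0 := by
      rw [hv, h1]; simp
    omega
  · have : (((1 - t).val : ℕ) : ℤ) = (L : ℤ) + 1 - t.val := by
      rw [hv]
      have h2 : (1 - (t.val : ℤ)) = ((L : ℤ) + 1 - t.val) + (L : ℤ) * (-1) := by ring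
      rw [h2, Int.add_mul_emod_self_left]
      exact Int.emod_eq_of_lt (by omega) (by omega)
    omega

end JV

/-! ### The reflection `Θ` of configurations -/

section Reflect

variable (j : Fin d) (k : ZMod L)

/-- The reflected link, as a positively oriented link: `(x, none) ↦ (rx, none)`,
`(x, i) ↦ (rx, i)` for `i ≠ j`, and `(x, j) ↦ (rx - e_j, j)` (the image of the bond from `x` to
`x + e_j` is the bond from `rx - e_j = r(x + e_j)` to `rx`, traversed backwards). [cite: BorgsSeiler1983, §II.2 (pp. 331–332)] -/
def reflLink (e : Link d L) : Link d L :=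
  (if e.2 = some j then mirror j k e.1 - Pi.single j 1 else mirror j k e.1, e.2)

/-- The reflected time-like loop. [folklore] -/
@[simp] theorem reflLink_none (x : TorusSite d L) :
    reflLink j k (x, none) = (mirror j k x, none) := by simp [reflLink]

/-- The reflected `j`-link. [folklore] -/
@[simp] theorem reflLink_self (x : TorusSite d L) :
    reflLink j k (x, some j) = (mirror j k x - Pi.single j 1, some j) := by simp [reflLink]

/-- The reflected spatial link in a direction `i ≠ j`. [folklore] -/
theorem reflLink_of_ne {i : Fin d} (hi : i ≠ j) (x : TorusSite d L) :
    reflLink j k (x, some i) = (mirror j k x, some i) := by simp [reflLink, hi]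

/-- `reflLink` preserves the direction. [folklore] -/
@[simp] theorem reflLink_snd (e : Link d L) : (reflLink j k e).2 = e.2 := rfl

/-- `reflLink` is an involution. [folklore] -/
theorem reflLink_reflLink (e : Link d L) : reflLink j k (reflLink j k e) = e := by
  rcases e with ⟨x, _ | i⟩
  · rw [reflLink_none, reflLink_none, mirror_mirror]
  · by_cases hi : i = j
    · subst hi
      rw [reflLink_self, reflLink_self, mirror_sub_single_self, mirror_mirror, add_sub_cancel_right]
    · rw [reflLink_of_ne j k hi, reflLink_of_ne j k hi, mirror_mirror]

/-- `reflLink` as a permutation of the links. [folklore] -/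
def reflLinkEquiv : Equiv.Perm (Link d L) where
  toFun := reflLink j k
  invFun := reflLink j k
  left_inv := reflLink_reflLink j k
  right_inv := reflLink_reflLink j k

/-- Inversion of the `j`-link variables. [folklore] -/
def invIf (e : Link d L) (g : G) : G := if e.2 = some j then g⁻¹ else g

/-- **The reflection `Θ` of the one-layer lattice gauge theory through the bond-bisecting
hyperplanes in direction `j`**: `(ΘU)(x, none) = u_{rx}`, `(ΘU)(x, i) = v_{rx, i}` (`i ≠ j`),
`(ΘU)(x, j) = v_{rx - e_j, j}⁻¹`. [cite: BorgsSeiler1983, §II.2 (pp. 331–332)] -/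
def reflect (U : Config d L G) : Config d L G := fun e => invIf j e (U (reflLink j k e))

/-- `Θ` on the time-like loops. [folklore] -/
@[simp] theorem reflect_none (U : Config d L G) (x : TorusSite d L) :
    reflect j k U (x, none) = U (mirror j k x, none) := by simp [reflect, invIf]

/-- `Θ` on the `j`-links (inverted). [folklore] -/
@[simp] theorem reflect_self (U : Config d L G) (x : TorusSite d L) :
    reflect j k U (x, some j) = (U (mirror j k x - Pi.single j 1, some j))⁻¹ := by
  simp [reflect, invIf]

/-- `Θ` on the spatial links in a direction `i ≠ j`. [folklore] -/
theorem reflect_of_ne (U : Config d L G) {i : Fin d} (hi : i ≠ j) (x : TorusSite d L) :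
    reflect j k U (x, some i) = U (mirror j k x, some i) := by
  simp [reflect, invIf, hi, reflLink_of_ne j k hi]

/-- `Θ` is an involution. [folklore] -/
theorem reflect_reflect (U : Config d L G) : reflect j k (reflect j k U) = U := by
  funext e
  rcases e with ⟨x, _ | i⟩
  · rw [reflect_none, reflect_none, mirror_mirror]
  · by_cases hi : i = j
    · subst hi
      rw [reflect_self, reflect_self, mirror_sub_single_self, mirror_mirror, add_sub_cancel_right,
        inv_inv]
    · rw [reflect_of_ne j k _ hi, reflect_of_ne j k _ hi, mirror_mirror]

/-- The value of `ΘU` at a link is a function of the single coordinate `U (reflLink e)`. [folklore] -/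
theorem reflect_apply (U : Config d L G) (e : Link d L) :
    reflect j k U e = invIf j e (U (reflLink j k e)) := rfl

variable [TopologicalSpace G] [IsTopologicalGroup G] [CompactSpace G] [MeasurableSpace G]
  [BorelSpace G]

omit [TopologicalSpace G] [IsTopologicalGroup G] [CompactSpace G] [BorelSpace G] [Group G] in
/-- Relabelling by `reflLink` as a measurable equivalence. [folklore] -/
def reflRelabel : Config d L G ≃ᵐ Config d L G :=
  MeasurableEquiv.piCongrLeft (fun _ : Link d L => G) (reflLinkEquiv j k).symm

omit [TopologicalSpace G] [IsTopologicalGroup G] [CompactSpace G] [BorelSpace G] [Group G] in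
/-- The relabelling is `U ↦ U ∘ reflLink`. [folklore] -/
theorem coe_reflRelabel :
    ⇑(reflRelabel (G := G) j k) = fun (U : Config d L G) e => U (reflLink j k e) := by
  funext U; funext e
  rw [reflRelabel, MeasurableEquiv.coe_piCongrLeft, Equiv.piCongrLeft_apply_eq_cast, cast_eq]
  rfl

/-- **`Θ` preserves the product Haar measure** (a permutation of the factors followed by
inversion of the `j`-link factors). [folklore] -/
theorem measurePreserving_reflect [NeZero L] :
    MeasurePreserving (reflect (G := G) j k) (piMeasure (ι := Link d L) (haarProbability G))
      (piMeasure (ι := Link d L) (haarProbability G)) := by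
  have h1 : MeasurePreserving (reflRelabel (G := G) j k)
      (piMeasure (ι := Link d L) (haarProbability G))
      (piMeasure (ι := Link d L) (haarProbability G)) :=
    measurePreserving_piCongrLeft (fun _ : Link d L => haarProbability G) (reflLinkEquiv j k).symm
  have h2 : MeasurePreserving (fun (V : Config d L G) e => invIf j e (V e))
      (piMeasure (ι := Link d L) (haarProbability G))
      (piMeasure (ι := Link d L) (haarProbability G)) := by
    refine measurePreserving_pi (fun _ : Link d L => haarProbability G)
      (fun _ : Link d L => haarProbability G) fun e => ?_
    by_cases he : e.2 = some j
    · have : invIf (G := G) j e = Inv.inv := by funext g; simp [invIf, he]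
      rw [this]
      exact Measure.measurePreserving_inv _
    · have : invIf (G := G) j e = id := by funext g; simp [invIf, he]
      rw [this]
      exact MeasurePreserving.id _
  have h := h2.comp h1
  have hcomp : (fun (V : Config d L G) e => invIf j e (V e)) ∘ ⇑(reflRelabel (G := G) j k) =
      reflect j k := by
    funext U
    rw [Function.comp_apply, coe_reflRelabel]
    rfl
  rwa [hcomp] at h

omit [CompactSpace G] in
/-- `Θ` is measurable. [folklore] -/
theorem measurable_reflect : Measurable (reflect (G := G) (d := d) (L := L) j k) := by
  refine measurable_pi_lambda _ fun e => ?_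
  by_cases he : e.2 = some j
  · have : (fun U : Config d L G => reflect j k U e) = fun U => (U (reflLink j k e))⁻¹ := by
      funext U; simp [reflect, invIf, he]
    rw [this]
    exact (measurable_pi_apply _).inv
  · have : (fun U : Config d L G => reflect j k U e) = fun U => U (reflLink j k e) := by
      funext U; simp [reflect, invIf, he]
    rw [this]
    exact measurable_pi_apply _

omit [CompactSpace G] [MeasurableSpace G] [BorelSpace G] in
/-- `Θ` is continuous. [folklore] -/
theorem continuous_reflect : Continuous (reflect (G := G) (d := d) (L := L) j k) := by
  refine continuous_pi fun e => ?_
  by_cases he : e.2 = some j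
  · have : (fun U : Config d L G => reflect j k U e) = fun U => (U (reflLink j k e))⁻¹ := by
      funext U; simp [reflect, invIf, he]
    rw [this]
    exact (continuous_apply _).inv
  · have : (fun U : Config d L G => reflect j k U e) = fun U => U (reflLink j k e) := by
      funext U; simp [reflect, invIf, he]
    rw [this]
    exact continuous_apply _

/-! ### Plaquettes and Polyakov loops under `Θ` -/

variable (ρ : G →* Matrix (Fin N) (Fin N) ℂ)

omit [TopologicalSpace G] [IsTopologicalGroup G] [CompactSpace G] [MeasurableSpace G]
  [BorelSpace G] in
/-- Polyakov loops: `χ(u_x) ∘ Θ = χ(u_{rx})`. [folklore] -/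
theorem polyakov_reflect (U : Config d L G) (x : TorusSite d L) :
    polyakov ρ (reflect j k U) x = polyakov ρ U (mirror j k x) := by
  rw [polyakov, polyakov, reflect_none]

omit [TopologicalSpace G] [IsTopologicalGroup G] [CompactSpace G] [MeasurableSpace G]
  [BorelSpace G] in
/-- Electric plaquettes in a direction `i ≠ j` are relabelled. [folklore] -/
theorem eplaq_reflect_of_ne (U : Config d L G) {i : Fin d} (hi : i ≠ j) (x : TorusSite d L) :
    eplaq (reflect j k U) x i = eplaq U (mirror j k x) i := by
  simp only [eplaq, reflect_none, reflect_of_ne j k U hi, mirror_add_single_of_ne j k hi]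

omit [TopologicalSpace G] [IsTopologicalGroup G] [CompactSpace G] [MeasurableSpace G]
  [BorelSpace G] in
/-- Electric plaquettes in direction `j` go to conjugates of inverses of the mirror plaquettes:
with `y = rx - e_j` and `c = v_{y,j}`, `U_P(ΘU; x, j) = c⁻¹ U_P(U; y, j)⁻¹ c`. [folklore] -/
theorem eplaq_reflect_self (U : Config d L G) (x : TorusSite d L) :
    eplaq (reflect j k U) x j =
      (U (mirror j k x - Pi.single j 1, some j))⁻¹ *
        (eplaq U (mirror j k x - Pi.single j 1) j)⁻¹ * U (mirror j k x - Pi.single j 1, some j) := by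
  simp only [eplaq, reflect_none, reflect_self, mirror_add_single_self, sub_add_cancel, mul_inv_rev,
    inv_inv]
  group

omit [TopologicalSpace G] [IsTopologicalGroup G] [CompactSpace G] [MeasurableSpace G]
  [BorelSpace G] in
/-- The mirror base point of the bond `(x, i)`: `rx` for `i ≠ j`, `rx - e_j` for `i = j`. [folklore] -/
def bondMirror (b : TorusSite d L × Fin d) : TorusSite d L × Fin d :=
  (if b.2 = j then mirror j k b.1 - Pi.single j 1 else mirror j k b.1, b.2)

omit [TopologicalSpace G] [IsTopologicalGroup G] [CompactSpace G] [MeasurableSpace G]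
  [BorelSpace G] in
/-- `bondMirror` is an involution. [folklore] -/
theorem bondMirror_bondMirror (b : TorusSite d L × Fin d) : bondMirror j k (bondMirror j k b) = b := by
  rcases b with ⟨x, i⟩
  by_cases hi : i = j
  · subst hi
    simp only [bondMirror, if_true, Prod.mk.injEq, and_true]
    rw [mirror_sub_single_self, mirror_mirror, add_sub_cancel_right]
  · simp only [bondMirror, hi, if_false, Prod.mk.injEq, and_true]
    rw [mirror_mirror]

omit [TopologicalSpace G] [IsTopologicalGroup G] [CompactSpace G] [MeasurableSpace G]
  [BorelSpace G] in
/-- **`Re tr ρ` of electric plaquettes is carried to the mirror bond by `Θ`.** [folklore] -/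
theorem trace_re_eplaq_reflect (hρu : ∀ g, ρ g ∈ Matrix.unitaryGroup (Fin N) ℂ) (U : Config d L G)
    (x : TorusSite d L) (i : Fin d) :
    (ρ (eplaq (reflect j k U) x i)).trace.re =
      (ρ (eplaq U (bondMirror j k (x, i)).1 i)).trace.re := by
  by_cases hi : i = j
  · subst hi
    rw [eplaq_reflect_self]
    simp only [bondMirror, if_true]
    set c := U (mirror i k x - Pi.single i 1, some i)
    have h := FiniteTemperature.trace_re_rep_conj ρ c (eplaq U (mirror i k x - Pi.single i 1) i)⁻¹
    rw [h, FiniteTemperature.trace_re_rep_inv ρ hρu]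
  · rw [eplaq_reflect_of_ne j k U hi]
    simp [bondMirror, hi]

omit [TopologicalSpace G] [IsTopologicalGroup G] [CompactSpace G] [MeasurableSpace G]
  [BorelSpace G] in
/-- Magnetic plaquettes in directions `a, b ≠ j` are relabelled. [folklore] -/
theorem mplaq_reflect_of_ne_of_ne (U : Config d L G) {a b : Fin d} (ha : a ≠ j) (hb : b ≠ j)
    (x : TorusSite d L) : mplaq (reflect j k U) x a b = mplaq U (mirror j k x) a b := by
  simp only [mplaq, reflect_of_ne j k U ha, reflect_of_ne j k U hb, mirror_add_single_of_ne j k ha,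
    mirror_add_single_of_ne j k hb]

omit [TopologicalSpace G] [IsTopologicalGroup G] [CompactSpace G] [MeasurableSpace G]
  [BorelSpace G] in
/-- Magnetic plaquettes in directions `(j, b)`: with `y = rx - e_j`, `c = v_{y,j}`,
`U_P(ΘU; x, j, b) = c⁻¹ U_P(U; y, j, b)⁻¹ c`. [folklore] -/
theorem mplaq_reflect_self_left (U : Config d L G) {b : Fin d} (hb : b ≠ j) (x : TorusSite d L) :
    mplaq (reflect j k U) x j b =
      (U (mirror j k x - Pi.single j 1, some j))⁻¹ *
        (mplaq U (mirror j k x - Pi.single j 1) j b)⁻¹ * U (mirror j k x - Pi.single j 1, some j) := by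
  simp only [mplaq, reflect_self, reflect_of_ne j k U hb, mirror_add_single_self,
    mirror_add_single_of_ne j k hb, sub_add_cancel, mul_inv_rev, inv_inv]
  have h : mirror j k x + Pi.single b 1 - Pi.single j 1 = mirror j k x - Pi.single j 1 + Pi.single b 1 :=
    by rw [add_sub_right_comm]
  rw [h]
  group

omit [TopologicalSpace G] [IsTopologicalGroup G] [CompactSpace G] [MeasurableSpace G]
  [BorelSpace G] in
/-- Magnetic plaquettes in directions `(a, j)`: with `y = rx - e_j`, `c = v_{y,j}`,
`U_P(ΘU; x, a, j) = c⁻¹ U_P(U; y, a, j)⁻¹ c`. [folklore] -/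
theorem mplaq_reflect_self_right (U : Config d L G) {a : Fin d} (ha : a ≠ j) (x : TorusSite d L) :
    mplaq (reflect j k U) x a j =
      (U (mirror j k x - Pi.single j 1, some j))⁻¹ *
        (mplaq U (mirror j k x - Pi.single j 1) a j)⁻¹ * U (mirror j k x - Pi.single j 1, some j) := by
  simp only [mplaq, reflect_self, reflect_of_ne j k U ha, mirror_add_single_self,
    mirror_add_single_of_ne j k ha, sub_add_cancel, mul_inv_rev, inv_inv]
  have h : mirror j k x + Pi.single a 1 - Pi.single j 1 = mirror j k x - Pi.single j 1 + Pi.single a 1 :=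
    by rw [add_sub_right_comm]
  rw [h]
  group

omit [TopologicalSpace G] [IsTopologicalGroup G] [CompactSpace G] [MeasurableSpace G]
  [BorelSpace G] in
/-- The mirror base point of the plaquette `(x; a, b)`: `rx - e_j` if `j ∈ {a, b}`, else `rx`. [folklore] -/
def plaqMirrorBase (x : TorusSite d L) (a b : Fin d) : TorusSite d L :=
  if a = j ∨ b = j then mirror j k x - Pi.single j 1 else mirror j k x

omit [TopologicalSpace G] [IsTopologicalGroup G] [CompactSpace G] [MeasurableSpace G]
  [BorelSpace G] in
/-- `plaqMirrorBase` is an involution (for fixed directions). [folklore] -/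
theorem plaqMirrorBase_plaqMirrorBase (x : TorusSite d L) (a b : Fin d) :
    plaqMirrorBase j k (plaqMirrorBase j k x a b) a b = x := by
  by_cases h : a = j ∨ b = j
  · simp only [plaqMirrorBase, h, if_true]
    rw [mirror_sub_single_self, mirror_mirror, add_sub_cancel_right]
  · simp only [plaqMirrorBase, h, if_false]
    rw [mirror_mirror]

omit [TopologicalSpace G] [IsTopologicalGroup G] [CompactSpace G] [MeasurableSpace G]
  [BorelSpace G] in
/-- **`Re tr ρ` of magnetic plaquettes is carried to the mirror plaquette by `Θ`** (for
`a ≠ b`). [folklore] -/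
theorem trace_re_mplaq_reflect (hρu : ∀ g, ρ g ∈ Matrix.unitaryGroup (Fin N) ℂ) (U : Config d L G)
    (x : TorusSite d L) {a b : Fin d} (hab : a ≠ b) :
    (ρ (mplaq (reflect j k U) x a b)).trace.re =
      (ρ (mplaq U (plaqMirrorBase j k x a b) a b)).trace.re := by
  by_cases ha : a = j
  · subst ha
    have hb : b ≠ a := fun h => hab h.symm
    rw [mplaq_reflect_self_left a k U hb]
    simp only [plaqMirrorBase, true_or, if_true]
    rw [FiniteTemperature.trace_re_rep_conj ρ, FiniteTemperature.trace_re_rep_inv ρ hρu]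
  · by_cases hb : b = j
    · subst hb
      rw [mplaq_reflect_self_right b k U ha]
      simp only [plaqMirrorBase, or_true, if_true]
      rw [FiniteTemperature.trace_re_rep_conj ρ, FiniteTemperature.trace_re_rep_inv ρ hρu]
    · rw [mplaq_reflect_of_ne_of_ne j k U ha hb]
      simp [plaqMirrorBase, ha, hb]

end Reflect

/-! ### Reflection positivity with two different crossing couplings: the Cauchy–Schwarz step -/

section ThetaCS

open Literature.Probability.LatticeModels.NVector (expTaylor kernel_expTaylor_expand
  truncated_cauchySchwarz tendsto_expTaylor abs_expTaylor_le continuous_expTaylor abs_sum_mul_le)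

variable {ι : Type*} [Fintype ι] [DecidableEq ι] {X : Type*} [MeasurableSpace X]
  (μ₀ : Measure X) [IsProbabilityMeasure μ₀] (P : Finset ι) (Θ : (ι → X) → (ι → X))
  {C : Type*} [Fintype C]

omit [Fintype ι] [DecidableEq ι] [Fintype C] in
/-- Change of variables along a measure-preserving map (real integrand, no embedding
hypothesis). [folklore] -/
theorem integral_comp_eq_of_measurePreserving_real {Y Z : Type*} [MeasurableSpace Y]
    [MeasurableSpace Z] {ν : Measure Y} {ν' : Measure Z} {T : Y → Z} (hT : MeasurePreserving T ν ν')
    {F : Z → ℝ} (hFm : Measurable F) : ∫ y, F (T y) ∂ν = ∫ z, F z ∂ν' := by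
  rw [← integral_map hT.measurable.aemeasurable hFm.aestronglyMeasurable, hT.map_eq]

omit [Fintype C] in
/-- **Factorisation of one word**: if `A`, `B` depend only on the `P`-coordinates, `Θ` preserves
the product measure and the `P`-coordinates of `Θ U` depend only on `U` off `P`, then
`∫ A(U) B(ΘU) dμ = (∫ A dμ)(∫ B dμ)` (independence of the two blocks and `Θ`-invariance).
[folklore] -/
theorem integral_mul_comp_eq_mul (hΘ : MeasurePreserving Θ (piMeasure μ₀) (piMeasure μ₀))
    (hΘdep : ∀ e ∈ P, DependsOn (fun U => Θ U e) ((Pᶜ : Finset ι) : Set ι))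
    {A B : (ι → X) → ℝ} (hAm : Measurable A) (hBm : Measurable B)
    (hAdep : DependsOn A (P : Set ι)) (hBdep : DependsOn B (P : Set ι)) :
    ∫ U, A U * B (Θ U) ∂piMeasure μ₀ = (∫ U, A U ∂piMeasure μ₀) * ∫ U, B U ∂piMeasure μ₀ := by
  have hBΘdep : DependsOn (fun U => B (Θ U)) ((Pᶜ : Finset ι) : Set ι) := by
    intro U V hUV
    apply hBdep
    intro e he
    exact hΘdep e (Finset.mem_coe.1 he) hUV
  have h := Literature.MathematicalPhysics.QuantumFieldTheory.LatticeRP.integral_mul_eq_of_dependsOn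
    μ₀ P Pᶜ disjoint_compl_right (f := fun U => (A U : ℂ)) (g := fun U => (B (Θ U) : ℂ))
    (Complex.measurable_ofReal.comp hAm) (Complex.measurable_ofReal.comp (hBm.comp hΘ.measurable))
    (fun U V hUV => by simp only [hAdep hUV]) (fun U V hUV => by simp only [hBΘdep hUV])
  have hΘint : ∫ U, (B (Θ U) : ℂ) ∂piMeasure μ₀ = ∫ U, (B U : ℂ) ∂piMeasure μ₀ :=
    Literature.MathematicalPhysics.QuantumFieldTheory.LatticeRP.integral_comp_eq_of_measurePreserving
      hΘ (Φ := fun U => (B U : ℂ)) (Complex.measurable_ofReal.comp hBm)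
  rw [hΘint] at h
  simp only [← Complex.ofReal_mul, integral_complex_ofReal] at h
  exact_mod_cast h

variable {μ₀ P Θ}

omit [Fintype ι] [DecidableEq ι] [MeasurableSpace X] [Fintype C] in
/-- Products of `P`-dependent functions are `P`-dependent. [folklore] -/
theorem dependsOn_mul_prod {F : (ι → X) → ℝ} {f : C → (ι → X) → ℝ}
    (hF : DependsOn F (P : Set ι)) (hf : ∀ c, DependsOn (f c) (P : Set ι)) {n : ℕ} (w : Fin n → C) :
    DependsOn (fun U => F U * ∏ i, f (w i) U) (P : Set ι) := fun U V hUV => by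
  simp only [hF hUV]
  congr 1
  exact Finset.prod_congr rfl fun i _ => hf (w i) hUV

omit [Fintype ι] [DecidableEq ι] [Fintype C] in
/-- Measurability of the word functions. [folklore] -/
theorem measurable_mul_prod {F : (ι → X) → ℝ} {f : C → (ι → X) → ℝ} (hF : Measurable F)
    (hf : ∀ c, Measurable (f c)) {n : ℕ} (w : Fin n → C) :
    Measurable fun U => F U * ∏ i, f (w i) U :=
  hF.mul (Finset.measurable_prod _ fun i _ => hf (w i))

omit [DecidableEq ι] [Fintype ι] [MeasurableSpace X] [Fintype C] in
/-- A bound for the word functions. [folklore] -/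
theorem abs_mul_prod_le {F : (ι → X) → ℝ} {f : C → (ι → X) → ℝ} {R : ℝ} (hR : 0 ≤ R)
    (hF : ∀ U, |F U| ≤ R) (hf : ∀ c U, |f c U| ≤ R) {n : ℕ} (w : Fin n → C) (U : ι → X) :
    |F U * ∏ i, f (w i) U| ≤ R * R ^ n := by
  rw [abs_mul]
  exact mul_le_mul (hF U) (Literature.Probability.LatticeModels.NVector.abs_prod_le_pow _
    fun i => hf (w i) U) (abs_nonneg _) hR

/-- **The truncated kernel factorises**:
`∫ F₁(U) F₂(ΘU) T_N(β∑_c f₁_c(U) f₂_c(ΘU)) dμ = ∑_{n<N} βⁿ/n! ∑_w (∫F₁∏f₁_w)(∫F₂∏f₂_w)`. [cite: FriedliVelenik2017, Lemma 10.28, eq. (10.44)] -/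
theorem integral_truncated_eq_sum (hΘ : MeasurePreserving Θ (piMeasure μ₀) (piMeasure μ₀))
    (hΘdep : ∀ e ∈ P, DependsOn (fun U => Θ U e) ((Pᶜ : Finset ι) : Set ι)) (β : ℝ) (N : ℕ)
    {F₁ F₂ : (ι → X) → ℝ} {f₁ f₂ : C → (ι → X) → ℝ} (hF₁m : Measurable F₁) (hF₂m : Measurable F₂)
    (hf₁m : ∀ c, Measurable (f₁ c)) (hf₂m : ∀ c, Measurable (f₂ c)) {R : ℝ} (hR : 0 ≤ R)
    (hF₁b : ∀ U, |F₁ U| ≤ R) (hF₂b : ∀ U, |F₂ U| ≤ R) (hf₁b : ∀ c U, |f₁ c U| ≤ R)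
    (hf₂b : ∀ c U, |f₂ c U| ≤ R) (hF₁dep : DependsOn F₁ (P : Set ι))
    (hF₂dep : DependsOn F₂ (P : Set ι)) (hf₁dep : ∀ c, DependsOn (f₁ c) (P : Set ι))
    (hf₂dep : ∀ c, DependsOn (f₂ c) (P : Set ι)) :
    ∫ U, F₁ U * F₂ (Θ U) * expTaylor N (β * ∑ c, f₁ c U * f₂ c (Θ U)) ∂piMeasure μ₀ =
      ∑ n ∈ Finset.range N, β ^ n / (n.factorial : ℝ) *
        ∑ w : Fin n → C, (∫ U, F₁ U * ∏ i, f₁ (w i) U ∂piMeasure μ₀) *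
          (∫ U, F₂ U * ∏ i, f₂ (w i) U ∂piMeasure μ₀) := by
  have hexp : ∀ U : ι → X, F₁ U * F₂ (Θ U) * expTaylor N (β * ∑ c, f₁ c U * f₂ c (Θ U)) =
      ∑ n ∈ Finset.range N, β ^ n / (n.factorial : ℝ) *
        ∑ w : Fin n → C, (F₁ U * ∏ i, f₁ (w i) U) * (F₂ (Θ U) * ∏ i, f₂ (w i) (Θ U)) :=
    fun U => kernel_expTaylor_expand (β := β) N F₁ F₂ f₁ f₂ (U, Θ U)
  simp_rw [hexp]
  have hint : ∀ (n : ℕ) (w : Fin n → C), Integrable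
      (fun U : ι → X => (F₁ U * ∏ i, f₁ (w i) U) * (F₂ (Θ U) * ∏ i, f₂ (w i) (Θ U)))
      (piMeasure μ₀) := by
    intro n w
    refine Integrable.of_bound (((measurable_mul_prod hF₁m hf₁m w).mul
      ((measurable_mul_prod hF₂m hf₂m w).comp hΘ.measurable)).aestronglyMeasurable)
      ((R * R ^ n) * (R * R ^ n)) (ae_of_all _ fun U => ?_)
    rw [Real.norm_eq_abs, abs_mul]
    exact mul_le_mul (abs_mul_prod_le hR hF₁b hf₁b w U) (abs_mul_prod_le hR hF₂b hf₂b w (Θ U))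
      (abs_nonneg _) (by positivity)
  rw [integral_finsetSum _ fun n _ => (Integrable.const_mul (integrable_finsetSum _
    fun w _ => hint n w) _)]
  refine Finset.sum_congr rfl fun n _ => ?_
  rw [integral_const_mul, integral_finsetSum _ fun w _ => hint n w]
  congr 1
  refine Finset.sum_congr rfl fun w _ => ?_
  exact integral_mul_comp_eq_mul μ₀ P Θ hΘ hΘdep (measurable_mul_prod hF₁m hf₁m w)
    (measurable_mul_prod hF₂m hf₂m w) (dependsOn_mul_prod hF₁dep hf₁dep w)
    (dependsOn_mul_prod hF₂dep hf₂dep w)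

omit [DecidableEq ι] in
/-- **Resumming**: the truncated kernels converge to the exponential one (dominated
convergence). [cite: FriedliVelenik2017, Lemma 10.28] -/
theorem tendsto_integral_truncated (hΘ : MeasurePreserving Θ (piMeasure μ₀) (piMeasure μ₀))
    (β : ℝ) {F₁ F₂ : (ι → X) → ℝ} {f₁ f₂ : C → (ι → X) → ℝ} (hF₁m : Measurable F₁)
    (hF₂m : Measurable F₂) (hf₁m : ∀ c, Measurable (f₁ c)) (hf₂m : ∀ c, Measurable (f₂ c))
    {R : ℝ} (hR : 0 ≤ R) (hF₁b : ∀ U, |F₁ U| ≤ R) (hF₂b : ∀ U, |F₂ U| ≤ R)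
    (hf₁b : ∀ c U, |f₁ c U| ≤ R) (hf₂b : ∀ c U, |f₂ c U| ≤ R) :
    Tendsto (fun N => ∫ U, F₁ U * F₂ (Θ U) * expTaylor N (β * ∑ c, f₁ c U * f₂ c (Θ U))
      ∂piMeasure μ₀) atTop
      (𝓝 (∫ U, F₁ U * F₂ (Θ U) * Real.exp (β * ∑ c, f₁ c U * f₂ c (Θ U)) ∂piMeasure μ₀)) := by
  have hΘm := hΘ.measurable
  have hS : Measurable fun U : ι → X => ∑ c, f₁ c U * f₂ c (Θ U) :=
    Finset.measurable_sum _ fun c _ => (hf₁m c).mul ((hf₂m c).comp hΘm)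
  have hFF : Measurable fun U : ι → X => F₁ U * F₂ (Θ U) := hF₁m.mul (hF₂m.comp hΘm)
  refine tendsto_integral_of_dominated_convergence
    (fun _ => R * R * Real.exp (|β| * (Fintype.card C * R ^ 2))) (fun N => ?_) (integrable_const _)
    (fun N => ae_of_all _ fun U => ?_) (ae_of_all _ fun U => (tendsto_expTaylor _).const_mul _)
  · exact (hFF.mul ((continuous_expTaylor N).measurable.comp (hS.const_mul β))).aestronglyMeasurable
  · rw [Real.norm_eq_abs, abs_mul, abs_mul]
    refine mul_le_mul (mul_le_mul (hF₁b U) (hF₂b _) (abs_nonneg _) hR) ?_ (abs_nonneg _)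
      (by positivity)
    refine (abs_expTaylor_le N _).trans (Real.exp_le_exp.2 ?_)
    rw [abs_mul]
    exact mul_le_mul_of_nonneg_left (abs_sum_mul_le hR (fun c => hf₁b c U) fun c => hf₂b c _)
      (abs_nonneg _)

/-- **Cauchy–Schwarz for the reflection-positive form with two different crossing couplings**
(Friedli–Velenik 2017, Lemma 10.28: `⟨e^{A+Θ(B)+∑C_αΘ(D_α)}⟩² ≤ ⟨e^{A+Θ(A)+∑C_αΘ(C_α)}⟩⟨e^{B+Θ(B)+∑D_αΘ(D_α)}⟩`;
Fröhlich–Israel–Lieb–Simon 1978): if `Θ` preserves the product probability measure and the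
`P`-coordinates of `Θ U` depend only on `U` off `P`, then for `β ≥ 0` and bounded measurable
`Φ, Ψ, p_c, q_c` depending only on the `P`-coordinates,
`(∫ Φ(U)Ψ(ΘU) e^{β∑ p_c(U) q_c(ΘU)})² ≤ (∫ ΦΦ∘Θ e^{β∑pp∘Θ}) (∫ ΨΨ∘Θ e^{β∑qq∘Θ})`. Proof as in the
tree's `NVector.kerInt_sq_le`: expand the exponential, factorise each word
(`integral_truncated_eq_sum`), Cauchy–Schwarz termwise (`NVector.truncated_cauchySchwarz`),
resum. [cite: FriedliVelenik2017, Lemma 10.28] -/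
theorem integral_mul_comp_mul_exp_sq_le (hΘ : MeasurePreserving Θ (piMeasure μ₀) (piMeasure μ₀))
    (hΘdep : ∀ e ∈ P, DependsOn (fun U => Θ U e) ((Pᶜ : Finset ι) : Set ι)) {β : ℝ} (hβ : 0 ≤ β)
    {Φ Ψ : (ι → X) → ℝ} {p q : C → (ι → X) → ℝ} (hΦm : Measurable Φ) (hΨm : Measurable Ψ)
    (hpm : ∀ c, Measurable (p c)) (hqm : ∀ c, Measurable (q c)) {R : ℝ} (hR : 0 ≤ R)
    (hΦb : ∀ U, |Φ U| ≤ R) (hΨb : ∀ U, |Ψ U| ≤ R) (hpb : ∀ c U, |p c U| ≤ R)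
    (hqb : ∀ c U, |q c U| ≤ R) (hΦdep : DependsOn Φ (P : Set ι)) (hΨdep : DependsOn Ψ (P : Set ι))
    (hpdep : ∀ c, DependsOn (p c) (P : Set ι)) (hqdep : ∀ c, DependsOn (q c) (P : Set ι)) :
    (∫ U, Φ U * Ψ (Θ U) * Real.exp (β * ∑ c, p c U * q c (Θ U)) ∂piMeasure μ₀) ^ 2 ≤
      (∫ U, Φ U * Φ (Θ U) * Real.exp (β * ∑ c, p c U * p c (Θ U)) ∂piMeasure μ₀) *
        ∫ U, Ψ U * Ψ (Θ U) * Real.exp (β * ∑ c, q c U * q c (Θ U)) ∂piMeasure μ₀ := by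
  have hM := tendsto_integral_truncated hΘ β hΦm hΨm hpm hqm hR hΦb hΨb hpb hqb
  have hA := tendsto_integral_truncated hΘ β hΦm hΦm hpm hpm hR hΦb hΦb hpb hpb
  have hB := tendsto_integral_truncated hΘ β hΨm hΨm hqm hqm hR hΨb hΨb hqb hqb
  refine le_of_tendsto_of_tendsto' (hM.pow 2) (hA.mul hB) fun N => ?_
  rw [integral_truncated_eq_sum hΘ hΘdep β N hΦm hΨm hpm hqm hR hΦb hΨb hpb hqb hΦdep hΨdep
      hpdep hqdep,
    integral_truncated_eq_sum hΘ hΘdep β N hΦm hΦm hpm hpm hR hΦb hΦb hpb hpb hΦdep hΦdep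
      hpdep hpdep,
    integral_truncated_eq_sum hΘ hΘdep β N hΨm hΨm hqm hqm hR hΨb hΨb hqb hqb hΨdep hΨdep
      hqdep hqdep]
  exact truncated_cauchySchwarz hβ N (fun n w => ∫ U, Φ U * ∏ i, p (w i) U ∂piMeasure μ₀)
    (fun n w => ∫ U, Ψ U * ∏ i, q (w i) U ∂piMeasure μ₀)

end ThetaCS

/-! ### The blocks of links and the hypotheses of reflection positivity -/

section Blocks

variable (j : Fin d) (k : ZMod L) [NeZero L]

/-- Sites of the positive half: `1 ≤ n(x) ≤ L/2` (the tree's `Torus.halfBetweenSites j k`). [cite: FriedliVelenik2017, §10.3, eq. (10.2)] -/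
def IsPosSite (x : TorusSite d L) : Prop := 1 ≤ jv j k x ∧ jv j k x ≤ L / 2

/-- Decidability of `IsPosSite`. [folklore] -/
instance (x : TorusSite d L) : Decidable (IsPosSite j k x) := by
  unfold IsPosSite; infer_instance

/-- Links with both endpoints in the positive half: `u_x` and `v_{x,i}` (`i ≠ j`) for `x`
positive, and `v_{x,j}` for `x`, `x + e_j` positive (`1 ≤ n(x) < L/2`). [folklore] -/
def IsPosLink (e : Link d L) : Prop := IsPosSite j k e.1 ∧ (e.2 = some j → jv j k e.1 < L / 2)

/-- Decidability of `IsPosLink`. [folklore] -/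
instance (e : Link d L) : Decidable (IsPosLink j k e) := by
  unfold IsPosLink; infer_instance

/-- The positive block of links. [folklore] -/
def posLinks : Finset (Link d L) := Finset.univ.filter (IsPosLink j k)

/-- The crossing links: the `j`-links bisected by the mirror, `v_{x,j}` with `n(x) ∈ {0, L/2}`. [folklore] -/
def IsCrossLink (e : Link d L) : Prop := e.2 = some j ∧ (jv j k e.1 = 0 ∨ jv j k e.1 = L / 2)

/-- Decidability of `IsCrossLink`. [folklore] -/
instance (e : Link d L) : Decidable (IsCrossLink j k e) := by
  unfold IsCrossLink; infer_instance

/-- The block of crossing links. [folklore] -/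
def crossLinks : Finset (Link d L) := Finset.univ.filter (IsCrossLink j k)

/-- Membership in the positive block. [folklore] -/
@[simp] theorem mem_posLinks (e : Link d L) : e ∈ posLinks j k ↔ IsPosLink j k e := by
  simp [posLinks]

/-- Membership in the crossing block. [folklore] -/
@[simp] theorem mem_crossLinks (e : Link d L) : e ∈ crossLinks j k ↔ IsCrossLink j k e := by
  simp [crossLinks]

/-- **`Θ` carries positive links off the positive block.** [folklore] -/
theorem reflLink_not_isPosLink (hL : Even L) (hL4 : 4 ≤ L) {e : Link d L} (he : IsPosLink j k e) :
    ¬ IsPosLink j k (reflLink j k e) := by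
  obtain ⟨M, hM⟩ := hL
  have hL2 : (L / 2 : ℕ) = M := by omega
  rcases e with ⟨x, μ⟩
  obtain ⟨⟨h1, h2⟩, h3⟩ := he
  simp only at h1 h2 h3
  have hm := jv_mirror j k (by omega) x
  rintro ⟨⟨g1, g2⟩, g3⟩
  by_cases hμ : μ = some j
  · subst hμ
    have h3' := h3 rfl
    simp only [reflLink_self] at g1 g2 g3
    have hs := jv_sub_single_self j k (mirror j k x)
    rw [hs] at g1 g2
    split_ifs at hm hs g1 g2 with ha hb hc <;> omega
  · have hr : reflLink j k (x, μ) = (mirror j k x, μ) := by simp [reflLink, hμ]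
    simp only [hr] at g1 g2
    split_ifs at hm with ha hb <;> omega

/-- The positive coordinates of `Θ U` depend only on `U` off the positive block (each is a
function of the single coordinate `U (reflLink e)`, which is not positive). [folklore] -/
theorem reflect_apply_dependsOn (hL : Even L) (hL4 : 4 ≤ L) :
    ∀ e ∈ posLinks j k, DependsOn (fun U : Config d L G => reflect j k U e)
      (((posLinks j k)ᶜ : Finset (Link d L)) : Set (Link d L)) := by
  intro e he U V hUV
  have hmem : reflLink j k e ∈ (((posLinks j k)ᶜ : Finset (Link d L)) : Set (Link d L)) := by
    rw [Finset.coe_compl, Set.mem_compl_iff, Finset.mem_coe, mem_posLinks]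
    exact reflLink_not_isPosLink j k hL hL4 ((mem_posLinks j k e).1 he)
  simp only [reflect_apply, hUV _ hmem]

end Blocks

/-! ### Gauge fixing of the crossing links -/

section GaugeFix

variable (j : Fin d) (k : ZMod L) [NeZero L]

/-- The gauge transformation killing the crossing links: `g(y) = v_{y - e_j, j}` if the bond from
`y - e_j` to `y` is a crossing bond (i.e. at the heads of the crossing links), `g = 1` elsewhere.
[cite: BorgsSeiler1983, §II.2 (p. 333)] -/
def gfix (Y : Config d L G) (y : TorusSite d L) : G :=
  if IsCrossLink j k (y - Pi.single j 1, some j) then Y (y - Pi.single j 1, some j) else 1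

/-- The tail of a crossing link is not the head of a crossing link (`L ≥ 4`). [folklore] -/
theorem not_isCrossLink_sub (hL : Even L) (hL4 : 4 ≤ L) {x : TorusSite d L}
    (hx : IsCrossLink j k (x, some j)) : ¬ IsCrossLink j k (x - Pi.single j 1, some j) := by
  obtain ⟨M, hM⟩ := hL
  have hL2 : (L / 2 : ℕ) = M := by omega
  obtain ⟨-, hx⟩ := hx
  rintro ⟨-, h⟩
  simp only at hx h
  have hs := jv_sub_single_self j k x
  rw [hs] at h
  split_ifs at h with h0 <;> omega

/-- **The axial gauge on the crossing links**: the gauge transformation `gfix` of the crossing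
values `Y` turns the configuration "`U` off the crossing links, `Y` on them" into "the gauge
transform of `U` off the crossing links, `1` on them". [cite: BorgsSeiler1983, §II.2 (p. 333)] -/
theorem gaugeAct_gfix_splice (hL : Even L) (hL4 : 4 ≤ L) (U Y : Config d L G) :
    gaugeAct (gfix j k Y) (splice (crossLinks j k) (U, Y)) =
      splice (crossLinks j k) (gaugeAct (gfix j k Y) U, 1) := by
  funext e
  by_cases he : IsCrossLink j k e
  · have he' : e ∈ crossLinks j k := (mem_crossLinks j k e).2 he
    rcases e with ⟨x, μ⟩
    have hμ : μ = some j := he.1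
    subst hμ
    have htail : gfix j k Y x = 1 := by
      simp [gfix, not_isCrossLink_sub j k hL hL4 he]
    have hhead : gfix j k Y (x + Pi.single j 1) = Y (x, some j) := by
      simp [gfix, add_sub_cancel_right, he]
    rw [gaugeAct_some, splice_apply, splice_apply, if_pos he', if_pos he', htail, hhead]
    simp
  · have he' : e ∉ crossLinks j k := fun h => he ((mem_crossLinks j k e).1 h)
    simp only [gaugeAct, splice_apply, if_neg he']

variable [TopologicalSpace G] [IsTopologicalGroup G] [CompactSpace G] [MeasurableSpace G]
  [BorelSpace G]

/-- A probability measure: the integral of a constant. [folklore] -/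
theorem integral_const_piMeasure (c : ℝ) :
    ∫ _U : Config d L G, c ∂piMeasure (ι := Link d L) (haarProbability G) = c := by
  simp [integral_const]

/-- **Gauge fixing of the crossing links** (Osterwalder–Seiler): for every bounded measurable
gauge-invariant function `f` of the configuration,
`∫ f dμ = ∫ f(U with all crossing j-links set to 1) dμ(U)`. Proof: split `U` into its crossing
coordinates `Y` and the rest (`LatticeRP.measurePreserving_splice`); for fixed `Y` the gauge
transformation `gfix Y` kills the crossing links (`gaugeAct_gfix_splice`) and is a
measure-preserving change of the remaining variables (`measurePreserving_gaugeAct`). [cite: BorgsSeiler1983, §II.2 (p. 333)] -/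
theorem integral_eq_integral_splice_crossLinks_one (hL : Even L) (hL4 : 4 ≤ L)
    {f : Config d L G → ℝ} (hf : ∀ g U, f (gaugeAct g U) = f U) (hfm : Measurable f) {K : ℝ}
    (hfb : ∀ U, |f U| ≤ K) :
    ∫ U, f U ∂piMeasure (ι := Link d L) (haarProbability G) =
      ∫ U, f (splice (crossLinks j k) (U, 1)) ∂piMeasure (ι := Link d L) (haarProbability G) := by
  set μ : Measure (Config d L G) := piMeasure (ι := Link d L) (haarProbability G) with hμ
  set C := crossLinks j k
  -- split the configuration along the crossing coordinates
  have h1 : ∫ U, f U ∂μ = ∫ z, f (splice C z) ∂(μ.prod μ) :=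
    (integral_comp_eq_of_measurePreserving_real
      (Literature.MathematicalPhysics.QuantumFieldTheory.LatticeRP.measurePreserving_splice
        (haarProbability G) C) hfm).symm
  have hmeas : Measurable fun z : Config d L G × Config d L G => f (splice C z) :=
    hfm.comp (Literature.MathematicalPhysics.QuantumFieldTheory.LatticeRP.measurable_splice C)
  have hint : Integrable (fun z : Config d L G × Config d L G => f (splice C z)) (μ.prod μ) :=
    Integrable.of_bound hmeas.aestronglyMeasurable K (ae_of_all _ fun z => by
      rw [Real.norm_eq_abs]; exact hfb _)
  rw [h1, integral_prod _ hint]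
  -- for fixed crossing values `Y`, gauge them away
  have hinner : ∀ Y : Config d L G,
      ∫ U, f (splice C (U, Y)) ∂μ = ∫ U, f (splice C (U, 1)) ∂μ := by
    intro Y
    have hpt : ∀ U, f (splice C (U, Y)) = f (splice C (gaugeAct (gfix j k Y) U, 1)) := by
      intro U
      rw [← hf (gfix j k Y) (splice C (U, Y)), gaugeAct_gfix_splice j k hL hL4]
    simp_rw [hpt]
    have hm1 : Measurable fun U : Config d L G => f (splice C (U, 1)) :=
      hfm.comp ((Literature.MathematicalPhysics.QuantumFieldTheory.LatticeRP.measurable_splice C).comp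
        (measurable_id.prodMk measurable_const))
    exact integral_comp_eq_of_measurePreserving_real (measurePreserving_gaugeAct (gfix j k Y))
      (F := fun U => f (splice C (U, 1))) hm1
  have hswap : ∀ U : Config d L G, ∫ Y, f (splice C (U, Y)) ∂μ = ∫ Y, f (splice C (U, Y)) ∂μ :=
    fun U => rfl
  -- the inner integral does not depend on `Y`; but `integral_prod` integrates `Y` inside:
  -- swap the roles using Fubini in the other order
  have h2 : ∫ U, ∫ Y, f (splice C (U, Y)) ∂μ ∂μ = ∫ Y, ∫ U, f (splice C (U, Y)) ∂μ ∂μ :=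
    integral_integral_swap hint
  rw [h2]
  simp_rw [hinner]
  exact integral_const_piMeasure _

end GaugeFix

end OneLayer

end Literature.Barriers.QuantumFields

end
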